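import Mathlib
import Summits.MatrixMultiplication.MatrixMultiplication.Theses.StrassenDefect
import Summits.MatrixMultiplication.MatrixMultiplication.Theorems.StrassenDefectJunkNecessaryCentral

/-!
# MatrixMultiplication / StrassenDefect — item `JunkNecessary` (stmt-MatrixMultiplication-4079)

`JunkNecessary`: for `m ≥ 2`, `N ≥ 1` there is NO polynomial degeneration
`m² ⊙ ⟨N,N,N⟩ = ⟨m²⟩ ⊗ ⟨N,N,N⟩ ⊵ ⟨mN,mN,mN⟩` (`PolyDegeneratesTo`, Alman 2021 §2.4): the
junk-free two-scale self-reduction is impossible ("the GIT floor `d_m(N) ≥ 1`" of the route).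

The route sketch goes through polystability (Bürgisser–Ikenmeyer 2017, Prop. 4.8 / Cor. 4.9) and
closed-orbit separation (Kempf–Ness / Luna), none of which is in the tree as a proved theorem.
We give instead an ELEMENTARY, UNCONDITIONAL proof via the invariant "dimension of the centre of
the associated algebra", in its tensor avatar `Central.central` (support files
`…StrassenDefectJunkNecessaryLift`, `…StrassenDefectJunkNecessaryCentral`):

* `⟨ν,ν,ν⟩` (structure tensor of `M_ν`, Bläser's coordinates `matMulTensor`) is concise in each
  leg and its central triples are scalar: a central triple `(X, Y, Z)` with `X a₀ a₀ = 0`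
  vanishes (`matMul_rigid`; the centre of `M_ν` is `ℂ`);
* the block projections onto two distinct blocks of `r ⊙ ⟨N,N,N⟩` (central idempotents of
  `M_N^r`) are central triples with linearly independent first components (`blocks_central`,
  `blocks_indep`);
* both tensors live on index sets of size `m²N²`; reindexing the source along a bijection
  (`polyDegeneratesTo_reindex`, `central_reindex`) the abstract theorem
  `Central.not_polyDegeneratesTo_of_central` applies.

References: J. Alman, *Limits on the universal method for matrix multiplication*, ToC 17 (2021),
§2.4 (degeneration); P. Bürgisser, C. Ikenmeyer, *Fundamental invariants of orbit closures*,
J. Algebra 477 (2017) §4–5 (the GIT route not taken here); M. Bläser, *Fast Matrix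
Multiplication*, ToC Graduate Surveys 5 (2013) §5 (`⟨k,m,n⟩`).
-/

-- single-conjunct summit: `Summit.<S>.<P>` repeats `MatrixMultiplication` by design (D-0017)
set_option linter.dupNamespace false

noncomputable section

namespace Summit.MatrixMultiplication.MatrixMultiplication.Theorems

open scoped BigOperators
open Literature.Barriers.MatrixMultiplication Literature.Computability.AlgebraicComplexity
open Central

namespace JunkNecessaryConcrete

variable {K : Type*} [CommRing K]

/-! ## Diagonal matrices act entrywise -/

/-- A diagonal matrix acts on the first leg by scaling. [folklore] -/
theorem lift₁_diagonal {ι κ μ : Type*} [Fintype ι] [DecidableEq ι] (d : ι → K)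
    (t : ι → κ → μ → K) : lift₁ (Matrix.diagonal d) t = fun a b c => d a * t a b c := by
  funext a b c
  rw [lift₁_apply, Finset.sum_eq_single a]
  · rw [Matrix.diagonal_apply_eq]
  · intro x _ hx; rw [Matrix.diagonal_apply_ne _ (Ne.symm hx), zero_mul]
  · exact fun h => absurd (Finset.mem_univ _) h

/-- A diagonal matrix acts on the second leg by scaling. [folklore] -/
theorem lift₂_diagonal {ι κ μ : Type*} [Fintype κ] [DecidableEq κ] (d : κ → K)
    (t : ι → κ → μ → K) : lift₂ (Matrix.diagonal d) t = fun a b c => d b * t a b c := by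
  funext a b c
  rw [lift₂_apply, Finset.sum_eq_single b]
  · rw [Matrix.diagonal_apply_eq]
  · intro x _ hx; rw [Matrix.diagonal_apply_ne _ (Ne.symm hx), zero_mul]
  · exact fun h => absurd (Finset.mem_univ _) h

/-- A diagonal matrix acts on the third leg by scaling. [folklore] -/
theorem lift₃_diagonal {ι κ μ : Type*} [Fintype μ] [DecidableEq μ] (d : μ → K)
    (t : ι → κ → μ → K) : lift₃ (Matrix.diagonal d) t = fun a b c => d c * t a b c := by
  funext a b c
  rw [lift₃_apply, Finset.sum_eq_single c]
  · rw [Matrix.diagonal_apply_eq]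
  · intro x _ hx; rw [Matrix.diagonal_apply_ne _ (Ne.symm hx), zero_mul]
  · exact fun h => absurd (Finset.mem_univ _) h

/-! ## Central triples of `r ⊙ ⟨N,N,N⟩`: block projections -/

/-- The block projection onto block `β₀` of `⟨r⟩ ⊗ ⟨N,N,N⟩ = r ⊙ ⟨N,N,N⟩` (the central idempotent
of the `β₀`-th factor of `M_N^r`, on all three legs) is a central triple. [folklore] -/
theorem blocks_central (r N : ℕ) (β₀ : Fin r) :
    (Matrix.diagonal (fun p : Fin r × (Fin N × Fin N) => if p.1 = β₀ then (1 : K) else 0),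
      Matrix.diagonal (fun p : Fin r × (Fin N × Fin N) => if p.1 = β₀ then (1 : K) else 0),
      Matrix.diagonal (fun p : Fin r × (Fin N × Fin N) => if p.1 = β₀ then (1 : K) else 0)) ∈
      central (kroneckerTensor (unitTensor K r) (matMulTensor K N N N)) := by
  refine ⟨?_, ?_⟩
  · show lift₁ (Matrix.diagonal _) _ = lift₃ (Matrix.diagonal _) _
    rw [lift₁_diagonal, lift₃_diagonal]
    funext ⟨β₁, x⟩ ⟨β₂, y⟩ ⟨β₃, z⟩
    simp only [kroneckerTensor_apply, unitTensor_apply]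
    by_cases h : β₁ = β₂ ∧ β₂ = β₃
    · obtain ⟨rfl, rfl⟩ := h; rfl
    · simp [h]
  · show lift₂ (Matrix.diagonal _) _ = lift₃ (Matrix.diagonal _) _
    rw [lift₂_diagonal, lift₃_diagonal]
    funext ⟨β₁, x⟩ ⟨β₂, y⟩ ⟨β₃, z⟩
    simp only [kroneckerTensor_apply, unitTensor_apply]
    by_cases h : β₁ = β₂ ∧ β₂ = β₃
    · obtain ⟨rfl, rfl⟩ := h; rfl
    · simp [h]

/-- Block projections of distinct blocks are linearly independent (blocks are non-empty when
`N ≥ 1`). [folklore] -/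
theorem blocks_indep {r N : ℕ} (hN : 0 < N) {β₁ β₂ : Fin r} (hβ : β₁ ≠ β₂) (f g : K)
    (h : f • Matrix.diagonal (fun p : Fin r × (Fin N × Fin N) => if p.1 = β₁ then (1 : K) else 0)
      + g • Matrix.diagonal (fun p : Fin r × (Fin N × Fin N) => if p.1 = β₂ then (1 : K) else 0)
      = 0) : f = 0 ∧ g = 0 := by
  set z : Fin N × Fin N := (⟨0, hN⟩, ⟨0, hN⟩)
  constructor
  · have := congr_fun (congr_fun h (β₁, z)) (β₁, z)
    simpa [Matrix.diagonal_apply_eq, hβ] using this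
  · have := congr_fun (congr_fun h (β₂, z)) (β₂, z)
    simpa [Matrix.diagonal_apply_eq, hβ.symm] using this

/-! ## `⟨ν,ν,ν⟩`: leg actions in closed form, conciseness, central triples are scalar -/

/-- Leg-1 action on `⟨k,m,n⟩` in closed form. [folklore] -/
theorem lift₁_matMulTensor {k m n : ℕ} (X : Matrix (Fin k × Fin n) (Fin k × Fin n) K)
    (a : Fin k × Fin n) (b : Fin k × Fin m) (c : Fin m × Fin n) :
    lift₁ X (matMulTensor K k m n) a b c = if b.2 = c.1 then X a (b.1, c.2) else 0 := by
  obtain ⟨b₁, b₂⟩ := b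
  obtain ⟨c₁, c₂⟩ := c
  rw [lift₁_apply, Finset.sum_eq_single (b₁, c₂)]
  · by_cases h : b₂ = c₁ <;> simp [matMulTensor, h]
  · rintro ⟨x, y⟩ - hne
    have : ¬ (x = b₁ ∧ b₂ = c₁ ∧ y = c₂) := fun ⟨hx, _, hy⟩ => hne (by rw [hx, hy])
    simp [matMulTensor, this]
  · exact fun h => absurd (Finset.mem_univ _) h

/-- Leg-2 action on `⟨k,m,n⟩` in closed form. [folklore] -/
theorem lift₂_matMulTensor {k m n : ℕ} (Y : Matrix (Fin k × Fin m) (Fin k × Fin m) K)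
    (a : Fin k × Fin n) (b : Fin k × Fin m) (c : Fin m × Fin n) :
    lift₂ Y (matMulTensor K k m n) a b c = if a.2 = c.2 then Y b (a.1, c.1) else 0 := by
  obtain ⟨a₁, a₂⟩ := a
  obtain ⟨c₁, c₂⟩ := c
  rw [lift₂_apply, Finset.sum_eq_single (a₁, c₁)]
  · by_cases h : a₂ = c₂ <;> simp [matMulTensor, h]
  · rintro ⟨x, y⟩ - hne
    have : ¬ (a₁ = x ∧ y = c₁ ∧ a₂ = c₂) := fun ⟨hx, hy, _⟩ => hne (by rw [← hx, hy])
    simp [matMulTensor, this]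
  · exact fun h => absurd (Finset.mem_univ _) h

/-- Leg-3 action on `⟨k,m,n⟩` in closed form. [folklore] -/
theorem lift₃_matMulTensor {k m n : ℕ} (Z : Matrix (Fin m × Fin n) (Fin m × Fin n) K)
    (a : Fin k × Fin n) (b : Fin k × Fin m) (c : Fin m × Fin n) :
    lift₃ Z (matMulTensor K k m n) a b c = if a.1 = b.1 then Z c (b.2, a.2) else 0 := by
  obtain ⟨a₁, a₂⟩ := a
  obtain ⟨b₁, b₂⟩ := b
  rw [lift₃_apply, Finset.sum_eq_single (b₂, a₂)]
  · by_cases h : a₁ = b₁ <;> simp [matMulTensor, h]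
  · rintro ⟨x, y⟩ - hne
    have : ¬ (a₁ = b₁ ∧ b₂ = x ∧ a₂ = y) := fun ⟨_, hx, hy⟩ => hne (by rw [← hx, ← hy])
    simp [matMulTensor, this]
  · exact fun h => absurd (Finset.mem_univ _) h

/-- `⟨ν,ν,ν⟩` is concise in the first leg (given an index `j₀ : Fin ν`). [folklore] -/
theorem matMul_concise₁ {ν : ℕ} (j₀ : Fin ν) (w : Fin ν × Fin ν → K)
    (hw : ∀ b c, ∑ a, w a * matMulTensor K ν ν ν a b c = 0) : w = 0 := by
  funext ⟨i, l⟩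
  have h : lift₁ (Matrix.of fun (_ : Fin ν × Fin ν) a => w a) (matMulTensor K ν ν ν) (i, l)
      (i, j₀) (j₀, l) = 0 := hw (i, j₀) (j₀, l)
  rw [lift₁_matMulTensor] at h
  simpa using h

/-- `⟨ν,ν,ν⟩` is concise in the second leg. [folklore] -/
theorem matMul_concise₂ {ν : ℕ} (l₀ : Fin ν) (w : Fin ν × Fin ν → K)
    (hw : ∀ a c, ∑ b, w b * matMulTensor K ν ν ν a b c = 0) : w = 0 := by
  funext ⟨i, j⟩
  have h : lift₂ (Matrix.of fun (_ : Fin ν × Fin ν) b => w b) (matMulTensor K ν ν ν) (i, l₀)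
      (i, j) (j, l₀) = 0 := hw (i, l₀) (j, l₀)
  rw [lift₂_matMulTensor] at h
  simpa using h

/-- `⟨ν,ν,ν⟩` is concise in the third leg. [folklore] -/
theorem matMul_concise₃ {ν : ℕ} (i₀ : Fin ν) (w : Fin ν × Fin ν → K)
    (hw : ∀ a b, ∑ c, w c * matMulTensor K ν ν ν a b c = 0) : w = 0 := by
  funext ⟨j, l⟩
  have h : lift₃ (Matrix.of fun (_ : Fin ν × Fin ν) c => w c) (matMulTensor K ν ν ν) (i₀, l)
      (i₀, j) (j, l) = 0 := hw (i₀, l) (i₀, j)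
  rw [lift₃_matMulTensor] at h
  simpa using h

/-- **Central triples of `⟨ν,ν,ν⟩` are scalar**: a central triple `(X, Y, Z)` with one vanishing
diagonal entry `X a₀ a₀ = 0` vanishes (the centre of `M_ν` is the line of scalars).
[folklore] -/
theorem matMul_rigid {ν : ℕ} (a₀ : Fin ν × Fin ν)
    (X Y Z : Matrix (Fin ν × Fin ν) (Fin ν × Fin ν) K)
    (hc : (X, Y, Z) ∈ central (matMulTensor K ν ν ν)) (h0 : X a₀ a₀ = 0) :
    X = 0 ∧ Y = 0 ∧ Z = 0 := by
  obtain ⟨h1, h2⟩ := hc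
  dsimp only at h1 h2
  have E1 : ∀ i l i' j j' l' : Fin ν, (if j = j' then X (i, l) (i', l') else 0) =
      (if i = i' then Z (j', l') (j, l) else 0) := by
    intro i l i' j j' l'
    have := congr_fun (congr_fun (congr_fun h1 (i, l)) (i', j)) (j', l')
    rwa [lift₁_matMulTensor, lift₃_matMulTensor] at this
  have E2 : ∀ i l i' j j' l' : Fin ν, (if l = l' then Y (i', j) (i, j') else 0) =
      (if i = i' then Z (j', l') (j, l) else 0) := by
    intro i l i' j j' l'
    have := congr_fun (congr_fun (congr_fun h2 (i, l)) (i', j)) (j', l')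
    rwa [lift₂_matMulTensor, lift₃_matMulTensor] at this
  obtain ⟨i₀, l₀⟩ := a₀
  have hZ : Z = 0 := by
    ext ⟨j', l'⟩ ⟨j, l⟩
    rw [Matrix.zero_apply]
    by_cases hj : j = j'
    · subst hj
      by_cases hl : l = l'
      · subst hl
        have s1 := E2 i₀ l i₀ j j l
        have s2 := E2 i₀ l₀ i₀ j j l₀
        have s3 := E1 i₀ l₀ i₀ j j l₀
        rw [if_pos rfl, if_pos rfl] at s1 s2 s3
        rw [← s1, s2, ← s3]
        exact h0
      · have s := E2 i₀ l i₀ j j l'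
        rw [if_neg hl, if_pos rfl] at s
        exact s.symm
    · have s := E1 i₀ l i₀ j j' l'
      rw [if_neg hj, if_pos rfl] at s
      exact s.symm
  subst hZ
  refine ⟨?_, ?_, rfl⟩
  · ext ⟨i, l⟩ ⟨i', l'⟩
    have s := E1 i l i' l₀ l₀ l'
    rw [if_pos rfl] at s
    rw [s]
    split_ifs <;> rfl
  · ext ⟨i', j⟩ ⟨i, j'⟩
    have s := E2 i l₀ i' j j' l₀
    rw [if_pos rfl] at s
    rw [s]
    split_ifs <;> rfl

end JunkNecessaryConcrete

open JunkNecessaryConcrete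

/-- **Item `JunkNecessary` of route StrassenDefect** (stmt-MatrixMultiplication-4079), exact
route decl: for `m ≥ 2`, `N ≥ 1` there is no degeneration (`PolyDegeneratesTo`, Alman §2.4)
`m² ⊙ ⟨N,N,N⟩ ⊵ ⟨mN,mN,mN⟩` — the junk-free two-scale self-reduction is impossible.
Proof: both tensors live on index sets of size `m²N²`; reindex the source along a bijection and
apply `Central.not_polyDegeneratesTo_of_central`: `⟨mN,mN,mN⟩` is concise with only scalar
central triples (`matMul_rigid`), while the block projections of two distinct blocks of
`m² ⊙ ⟨N,N,N⟩` are independent central triples (`blocks_central`, `blocks_indep`) — the centre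
`ℂ^{m²}` of `M_N^{m²}` cannot shrink to the centre `ℂ` of `M_{mN}` under degeneration.
Unconditional and GIT-free (no polystability / Kempf–Ness facts are used). [folklore] -/
theorem junkNecessary_proof :
    Summit.MatrixMultiplication.MatrixMultiplication.Theses.StrassenDefect.JunkNecessary := by
  unfold Summit.MatrixMultiplication.MatrixMultiplication.Theses.StrassenDefect.JunkNecessary
  intro m N hm hN hdeg
  have hmN : 0 < m * N := Nat.mul_pos (by omega) hN
  have hcard : Fintype.card (Fin (m * N) × Fin (m * N)) =
      Fintype.card (Fin (m ^ 2) × (Fin N × Fin N)) := by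
    simp only [Fintype.card_prod, Fintype.card_fin]; ring
  let e : Fin (m * N) × Fin (m * N) ≃ Fin (m ^ 2) × (Fin N × Fin N) :=
    Fintype.equivOfCardEq hcard
  have h1lt : 1 < m ^ 2 := by nlinarith
  have hβ : (⟨0, by omega⟩ : Fin (m ^ 2)) ≠ ⟨1, h1lt⟩ := by
    intro h
    have := congrArg Fin.val h
    simp at this
  let a₀ : Fin (m * N) × Fin (m * N) := (⟨0, hmN⟩, ⟨0, hmN⟩)
  have hc₁ := central_reindex e e e (blocks_central (K := ℂ) (m ^ 2) N ⟨0, by omega⟩)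
  have hc₂ := central_reindex e e e (blocks_central (K := ℂ) (m ^ 2) N ⟨1, h1lt⟩)
  have hsub : ∀ M : Matrix (Fin (m ^ 2) × (Fin N × Fin N)) (Fin (m ^ 2) × (Fin N × Fin N)) ℂ,
      M.submatrix e e = 0 → M = 0 := fun M h => by
    ext i j
    have := congr_fun (congr_fun h (e.symm i)) (e.symm j)
    simpa using this
  refine not_polyDegeneratesTo_of_central (matMul_concise₁ a₀.1) (matMul_concise₂ a₀.1)
    (matMul_concise₃ a₀.1) a₀ (matMul_rigid a₀) hc₁ hc₂ ?_ (polyDegeneratesTo_reindex hdeg e e e)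
  intro f g hfg
  refine blocks_indep hN hβ f g (hsub _ ?_)
  simpa [Matrix.submatrix_add, Matrix.submatrix_smul] using hfg

end Summit.MatrixMultiplication.MatrixMultiplication.Theorems
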